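import Summits.MatrixMultiplication.OmegaCensus.STPP211TFirstReflectC

/-!
# ω-census, `(2,1,1)^k` T-first kernel engine — reflection D: `psearch` and the leaf never refute a solution

HONEST FRAMING (pub-omega census; verbatim): lottery ticket; floor = certified bounds/negative ranges.
Census STRUCTURE bookkeeping of the STPP track (seat pub-omega-stpp-1, gen 38; STRUCTURE row B5, the threshold column
`T1(H) = max {k : (2,1,1)^k ⊆ H}`), not progress on `ω`: small patterns in small groups bound no exponent.

Fourth reflection file for `STPP211TFirstEngine.lean` (continues `…ReflectC`): §8 the induction on the fuel — from a state
satisfying `Inv`, `psearch` answers `false` (the death tests are confirmed on a lane still holding an owed code, the re-checked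
branching lane is open, and the child keeping the owed member of that lane satisfies `Inv` again; the heuristic `chooseBit` and
the salt play no role); §9 the LEAF — `tleaf = true` unfolded, the initial state (placement `p₀ = 0`, lane `0` cut to
`[1, n/2]`) satisfies `Inv` for a solution normalised at class `0`, hence `leaf_false`.

References: H. Cohn, R. Kleinberg, B. Szegedy, C. Umans, *Group-theoretic algorithms for matrix multiplication*, FOCS 2005
(arXiv:math/0511460), Def. 5.1.  Desk record: pub-omega HOME `pub-omega-stpp-1-g38/`.
-/

namespace Summit.MatrixMultiplication.OmegaCensus

namespace STPP211T

open STPP211Neg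
open Literature.Computability.Complexity (div_mod_block)
open Summit.MatrixMultiplication.OmegaCensus.T1Z2p5 (testBit_lowMask)
open Literature.Barriers.RiemannHypothesis.TuranCheck (beq_true_iff)

section SPhase2

variable {n K : ℕ} [NeZero n] (units : List ℕ) {L : List ℕ} {OC : ℕ} {p q cz : Fin K → ZMod n}

/-! ## 8. The placement search never refutes the solution -/

/-- The child states of the solution's branch satisfy the invariant: SECOND member of class `l ∈ O1` placed. -/
theorem inv_child1 (hn : 1 ≤ n) (hK : 1 ≤ K) (hM : ModelD p q cz) (hD : LeafData n K L OC cz) {O1 O2 : Finset (Fin K)}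
    {M S1 S2 : ℕ} (hI : Inv n K p q O1 O2 M S1 S2) {l : Fin K} (hl : l ∈ O1) (tg : ℕ) :
    Inv n K p q (O1.erase l) O2
      (Nat.xor (Nat.land M (Nat.xor (mkTC n K units).call (killT n K units L OC l.val (q l).val))) (psalt (2 ^ (q l).val) tg))
      (Nat.xor S1 (sbit n l.val)) S2 := by
  obtain ⟨hdis, hS1, hS2, hsent, h2, h1⟩ := hI
  have hl2 : l ∉ O2 := fun h => Finset.disjoint_left.1 hdis hl h
  refine ⟨?_, sent_xor hn hS1 l (O1.erase l) (fun l2 => by rw [Finset.mem_erase]; by_cases h : l2 = l <;> simp [h, hl]), hS2,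
    fun l'' => sent_update units hn M l _ tg l'' (hsent l''), fun l' hl' => ?_, fun l' hl' => ?_⟩
  · exact Finset.disjoint_of_subset_left (Finset.erase_subset _ _) hdis
  · have hll : l ≠ l' := fun e => hl2 (e ▸ hl')
    exact ⟨owed_update units hn hK hM hD M (inA_q l) (inA_p l') (ne_of_classes hM hll (inA_q l) (inA_p l')) tg (h2 l' hl').1,
      owed_update units hn hK hM hD M (inA_q l) (inA_q l') (ne_of_classes hM hll (inA_q l) (inA_q l')) tg (h2 l' hl').2⟩
  · have hll : l ≠ l' := fun e => (Finset.ne_of_mem_erase hl') e.symm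
    exact owed_update units hn hK hM hD M (inA_q l) (inA_q l') (ne_of_classes hM hll (inA_q l) (inA_q l')) tg
      (h1 l' (Finset.mem_of_mem_erase hl'))

/-- … FIRST member of class `l ∈ O2` placed (with the pair cut). -/
theorem inv_child2 (hn : 1 ≤ n) (hK : 1 ≤ K) (hM : ModelD p q cz) (hD : LeafData n K L OC cz)
    (hor : ∀ l, (p l).val < (q l).val) {O1 O2 : Finset (Fin K)} {M S1 S2 : ℕ} (hI : Inv n K p q O1 O2 M S1 S2) {l : Fin K}
    (hl : l ∈ O2) (tg : ℕ) :
    Inv n K p q (insert l O1) (O2.erase l)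
      (Nat.xor (Nat.land (Nat.land M (Nat.xor (mkTC n K units).call (killT n K units L OC l.val (p l).val)))
        (Nat.xor (mkTC n K units).call (Nat.mul (Nat.sub (Nat.add (2 ^ (p l).val) (2 ^ (p l).val)) 1)
          (Nat.shiftRight (sbit n l.val) (mkTC n K units).n)))) (psalt (2 ^ (p l).val) tg))
      (Nat.xor S1 (sbit n l.val)) (Nat.xor S2 (sbit n l.val)) := by
  obtain ⟨hdis, hS1, hS2, hsent, h2, h1⟩ := hI
  have hl1 : l ∉ O1 := fun h => Finset.disjoint_left.1 hdis h hl
  refine ⟨?_, sent_xor hn hS1 l (insert l O1) (fun l2 => by rw [Finset.mem_insert]; by_cases h : l2 = l <;> simp [h, hl1]),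
    sent_xor hn hS2 l (O2.erase l) (fun l2 => by rw [Finset.mem_erase]; by_cases h : l2 = l <;> simp [h, hl]),
    fun l'' => sent_update2 units M l (ZMod.val_lt _) tg l'' (hsent l''), fun l' hl' => ?_, fun l' hl' => ?_⟩
  · rw [Finset.disjoint_left]
    intro a ha
    rw [Finset.mem_insert] at ha
    rcases ha with rfl | ha
    · exact Finset.notMem_erase _ _
    · exact fun h => Finset.disjoint_left.1 hdis ha (Finset.mem_of_mem_erase h)
  · -- l' ∈ O2.erase l
    have hll : l ≠ l' := fun e => (Finset.ne_of_mem_erase hl') e.symm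
    have hl'2 := Finset.mem_of_mem_erase hl'
    have hcut : ∀ x : ZMod n, ¬ (l'.val = l.val ∧ x.val ≤ (p l).val) := fun x h => hll (Fin.ext h.1.symm)
    exact ⟨owed_update2 units hn hK hM hD M (inA_p l) (inA_p l') (ne_of_classes hM hll (inA_p l) (inA_p l')) (hcut _) tg
        (h2 l' hl'2).1,
      owed_update2 units hn hK hM hD M (inA_p l) (inA_q l') (ne_of_classes hM hll (inA_p l) (inA_q l')) (hcut _) tg
        (h2 l' hl'2).2⟩
  · -- l' ∈ insert l O1
    rw [Finset.mem_insert] at hl'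
    rcases hl' with rfl | hl'
    · exact owed_update2 units hn hK hM hD M (inA_p l') (inA_q l') (fun e => hM.1 l' e.symm)
        (fun h => absurd h.2 (not_le.2 (hor l'))) tg (h2 l' hl).2
    · have hll : l ≠ l' := fun e => hl1 (e ▸ hl')
      have hcut : ¬ (l'.val = l.val ∧ (q l').val ≤ (p l).val) := fun h => hll (Fin.ext h.1.symm)
      exact owed_update2 units hn hK hM hD M (inA_p l) (inA_q l') (ne_of_classes hM hll (inA_p l) (inA_q l')) hcut tg (h1 l' hl')

omit [NeZero n] in
/-- `S2 &&& sbit l` detects `l ∈ O2`. -/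
theorem land_sbit_eq (hn : 1 ≤ n) {S2 : ℕ} {O2 : Finset (Fin K)} (hS2 : ∀ i, S2.testBit i = true ↔ ∃ l ∈ O2, i = posn n l.val n)
    (l : Fin K) : Nat.beq (Nat.land S2 (sbit n l.val)) 0 = decide (l ∉ O2) := by
  by_cases hl : l ∈ O2
  · have : (Nat.land S2 (sbit n l.val)).testBit (posn n l.val n) = true := by
      rw [land_eq, sbit_eq, Nat.testBit_land, (hS2 _).2 ⟨l, hl, rfl⟩, Nat.testBit_two_pow_self]; rfl
    rw [IcosetW.beq_false_of_ne (ne_zero_of_testBit this)]; simp [hl]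
  · have : Nat.land S2 (sbit n l.val) = 0 := by
      apply Nat.eq_of_testBit_eq; intro i
      rw [land_eq, sbit_eq, Nat.testBit_land, Nat.zero_testBit, Nat.testBit_two_pow]
      by_cases hi : posn n l.val n = i
      · subst hi
        cases hb : S2.testBit (posn n l.val n)
        · rfl
        · obtain ⟨l2, hl2, he⟩ := (hS2 _).1 hb
          have := Fin.ext (posn_inj (n := n) (by omega) (by omega) he).1
          subst this; exact absurd hl2 hl
      · simp [hi]
    rw [this]; simp [hl]

/-- **THE PLACEMENT SEARCH NEVER REFUTES THE SOLUTION**: from a state satisfying the invariant, `psearch` returns `false`. -/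
theorem psearch_false (hn : 1 ≤ n) (hK : 1 ≤ K) (hM : ModelD p q cz) (hD : LeafData n K L OC cz)
    (hor : ∀ l, (p l).val < (q l).val) :
    ∀ (fuel : ℕ) (O1 O2 : Finset (Fin K)) (M S1 S2 : ℕ), Inv n K p q O1 O2 M S1 S2 →
      psearch (mkTC n K units) (EPupT n K units L OC) fuel M S1 S2 = false := by
  intro fuel
  induction fuel with
  | zero => intro _ _ _ _ _ _; rfl
  | succ fuel ih =>
      intro O1 O2 M S1 S2 hI
      show pnode (mkTC n K units) (EPupT n K units L OC) (psearch (mkTC n K units) (EPupT n K units L OC) fuel) M S1 S2 = false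
      unfold pnode
      simp only [force_eq]
      rw [dead1_false units hI, Bool.false_or, dead2_false units hM hI, Bool.false_or]
      -- the branching part
      generalize hsb : lowBit (chooseBit (mkTC n K units) _ _ S1 S2 (Nat.lor S1 S2)) = sb
      cases hS : Nat.beq (Nat.lor S1 S2) 0
      · rw [Bool.not_false, Bool.true_and]
        cases hg1 : Nat.beq sb 0
        · cases hg2 : Nat.beq (Nat.land (Nat.lor S1 S2) sb) sb
          · simp
          · rw [Bool.not_false, Bool.true_and, Bool.true_and]
            -- sb is the sentinel of an open lane l
            have hsb0 : sb ≠ 0 := fun e => by rw [e] at hg1; exact Bool.noConfusion hg1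
            have hx0 : chooseBit (mkTC n K units) _ _ S1 S2 (Nat.lor S1 S2) ≠ 0 := fun e => by
              rw [e, lowBit_zero] at hsb; exact hsb0 hsb.symm
            obtain ⟨i, -, hLi⟩ := lowBit_eq_two_pow hx0
            rw [hsb] at hLi
            have hSi : (Nat.lor S1 S2).testBit i = true := by
              have := congrArg (fun x => Nat.testBit x i) (beq_true_iff.1 hg2)
              simp only [land_eq, Nat.testBit_land, hLi, Nat.testBit_two_pow_self, Bool.and_true] at this
              exact this
            rw [lor_eq, Nat.testBit_lor, Bool.or_eq_true] at hSi
            have hl : ∃ l : Fin K, i = posn n l.val n ∧ (l ∈ O1 ∨ l ∈ O2) := by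
              rcases hSi with h | h
              · obtain ⟨l, hl, rfl⟩ := (hI.2.1 i).1 h; exact ⟨l, rfl, Or.inl hl⟩
              · obtain ⟨l, hl, rfl⟩ := (hI.2.2.1 i).1 h; exact ⟨l, rfl, Or.inr hl⟩
            obtain ⟨l, rfl, hl⟩ := hl
            have hsbl : sb = sbit n l.val := hLi
            subst hsbl
            exact children_false hn hK hM hD hor ih hI l hl _
        · simp
      · simp
where
  /-- the children of the solution's branch along the open lane `l` are not all refuted -/
  children_false (hn : 1 ≤ n) (hK : 1 ≤ K) (hM : ModelD p q cz) (hD : LeafData n K L OC cz)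
      (hor : ∀ l, (p l).val < (q l).val) {fuel : ℕ}
      (ih : ∀ (O1 O2 : Finset (Fin K)) (M S1 S2 : ℕ), Inv n K p q O1 O2 M S1 S2 →
        psearch (mkTC n K units) (EPupT n K units L OC) fuel M S1 S2 = false)
      {O1 O2 : Finset (Fin K)} {M S1 S2 : ℕ} (hI : Inv n K p q O1 O2 M S1 S2) (l : Fin K) (hl : l ∈ O1 ∨ l ∈ O2) (tg : ℕ) :
      children (mkTC n K units) (psearch (mkTC n K units) (EPupT n K units L OC) fuel) M S1 S2 (sbit n l.val)
        (EPlT n K units L OC l.val) tg = false := by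
    unfold children
    simp only [force_eq]
    rw [land_sbit_eq hn hI.2.2.1 l]
    have hV : ∀ x : ZMod n, M.testBit (posn n l.val x.val) = true →
        (laneVal (mkTC n K units) M (sbit n l.val)).testBit x.val = true := fun x hx => by
      rw [sbit_eq, posn_eq, testBit_laneVal, decide_eq_true (ZMod.val_lt x), Bool.true_and, ← posn_eq]; exact hx
    have hVle : laneVal (mkTC n K units) M (sbit n l.val) ≤ laneVal (mkTC n K units) M (sbit n l.val) := le_rfl
    rcases hl with hl | hl
    · -- second member: l ∈ O1, l ∉ O2
      have hl2 : l ∉ O2 := fun h => Finset.disjoint_left.1 hI.1 hl h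
      simp only [hl2, not_false_eq_true, decide_true, Bool.not_true]
      show allLow _ _ _ = false
      by_contra hall
      rw [Bool.not_eq_false] at hall
      have hb := allLow_spec _ _ _ hVle hall (q l).val (hV (q l) (hI.2.2.2.2.2 l hl))
      have hf := ih _ _ _ _ _ (inv_child1 units hn hK hM hD hI hl tg)
      unfold killT at hf
      rw [hf] at hb
      exact Bool.noConfusion hb
    · -- first member: l ∈ O2
      simp only [hl, not_true_eq_false, decide_false, Bool.not_false]
      show allLow _ _ _ = false
      by_contra hall
      rw [Bool.not_eq_false] at hall
      have hb := allLow_spec _ _ _ hVle hall (p l).val (hV (p l) (hI.2.2.2.2.1 l hl).1)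
      have hf := ih _ _ _ _ _ (inv_child2 units hn hK hM hD hor hI hl tg)
      unfold killT at hf
      rw [hf] at hb
      exact Bool.noConfusion hb

/-! ## 9. The leaf: the first placement and the initial state -/

section Leaf

/-- The class order computed by the leaf. -/
noncomputable def OCT (n K : ℕ) (units L : List ℕ) : ℕ :=
  orderCodes (mkTC n K units) L (maskL L) (negMask (mkTC n K units) L)

/-- The initial state of the leaf: all codes allowed, minus the kill pattern of the placement `(0, 0)`, lane `0` cut to
`[1, n/2]`, salted with the mask of `T`. -/
noncomputable def M0T (n K : ℕ) (units L : List ℕ) (OC : ℕ) : ℕ :=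
  Nat.xor (Nat.land (Nat.land (mkTC n K units).call (Nat.xor (mkTC n K units).call (killT n K units L OC 0 0)))
    (mkTC n K units).cut0) (maskL L)

omit [NeZero n] in
/-- `tleaf = true` unfolded: the order re-check passed and the placement search from the initial state answered `true`. -/
theorem tleaf_true {L : List ℕ} (h : tleaf (mkTC n K units) L (maskL L) = true) :
    orderOK (mkTC n K units) (maskL L) (OCT n K units L) = true ∧
    psearch (mkTC n K units) (EPupT n K units L (OCT n K units L)) (2 * K + 1) (M0T n K units L (OCT n K units L))
      (sbit n 0) (Nat.xor (mkTC n K units).sent (sbit n 0)) = true := by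
  have h' : (orderOK (mkTC n K units) (maskL L) (OCT n K units L) &&
      psearch (mkTC n K units) (EPupT n K units L (OCT n K units L)) (2 * K + 1) (M0T n K units L (OCT n K units L))
        (sbit n 0) (Nat.xor (mkTC n K units).sent (sbit n 0))) = true := by
    have := h; unfold tleaf at this; simp only [force_eq] at this; exact this
  exact Bool.and_eq_true_iff.1 h'

/-- Bits of `sent`, globally. -/
theorem testBit_sent_iff (hn : 1 ≤ n) (i : ℕ) :
    (mkTC n K units).sent.testBit i = true ↔ ∃ l : Fin K, i = posn n l.val n := by
  rcases Nat.lt_or_ge i 64 with hi | hi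
  · rw [testBit_sent_low units hi]
    constructor
    · intro h; exact Bool.noConfusion h
    · rintro ⟨l, hl⟩; rw [posn_eq] at hl; omega
  · obtain ⟨l, y, hy, rfl⟩ := pos_cases (n := n) (by omega) hi
    rcases Nat.lt_or_ge l K with hl | hl
    · rw [testBit_sent units hl hy]
      constructor
      · intro h; have := of_decide_eq_true h; subst this; exact ⟨⟨l, hl⟩, rfl⟩
      · rintro ⟨l', hl'⟩
        have := posn_inj (n := n) (l := l) (by omega) (by omega) (show posn n l y = posn n l'.val n from hl')
        simp [this.2]
    · have hW : 0 < 2 * n := by omega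
      have hv : Nat.shiftLeft 1 n < 2 ^ (2 * n) := by
        rw [shiftLeft_eq', Nat.one_shiftLeft]; exact Nat.pow_lt_pow_right (by norm_num) (by omega)
      rw [mkTC_sent, shiftLeft_eq', Nat.testBit_shiftLeft, testBit_repLanes _ _ _ hW hv,
        show 64 + l * (2 * n) + y - 64 = l * (2 * n) + y by omega]
      have hge : ¬ (l * (2 * n) + y < K * (2 * n)) := by
        have : K * (2 * n) ≤ l * (2 * n) := Nat.mul_le_mul_right _ hl; omega
      simp only [hge, decide_false, Bool.false_and, Bool.and_false, Bool.false_eq_true, false_iff, not_exists]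
      intro l' hl'
      have := posn_inj (n := n) (l := l) (by omega) (by omega) (show posn n l y = posn n l'.val n from hl')
      have := l'.isLt; omega

omit [NeZero n] in
/-- Bits of the initial state at a lane position with `call` set. -/
theorem testBit_M0T (hn64 : n ≤ 64) (hL : ∀ t ∈ L, t < n) {l y : ℕ} (hl : l < K) (hy : y < 2 * n) (hyn : y ≤ n) :
    (M0T n K units L OC).testBit (64 + l * (2 * n) + y) =
      (!(killT n K units L OC 0 0).testBit (64 + l * (2 * n) + y) && (mkTC n K units).cut0.testBit (64 + l * (2 * n) + y)) := by
  unfold M0T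
  have hcall : (mkTC n K units).call.testBit (64 + l * (2 * n) + y) = true := by rw [testBit_call units hl hy]; simp [hyn]
  rw [xor_eq, land_eq, land_eq, xor_eq, Nat.testBit_xor, Nat.testBit_land, Nat.testBit_land, Nat.testBit_xor, hcall,
    Nat.testBit_lt_two_pow (lt_of_lt_of_le (maskL_lt L hL) (Nat.pow_le_pow_right Nat.two_pos (by omega)))]
  cases (killT n K units L OC 0 0).testBit (64 + l * (2 * n) + y) <;>
    cases (mkTC n K units).cut0.testBit (64 + l * (2 * n) + y) <;> rfl

/-- **THE INITIAL STATE SATISFIES THE INVARIANT** for the solution normalised at class `0`: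
`p₀ = 0`, `1 ≤ q₀ ≤ n/2` (codes). -/
theorem inv_init (hn : 1 ≤ n) (hn64 : n ≤ 64) (hK : 1 ≤ K) (hM : ModelD p q cz) (hD : LeafData n K L OC cz)
    (hp0 : p ⟨0, hK⟩ = 0) (hq0 : 1 ≤ (q ⟨0, hK⟩).val ∧ (q ⟨0, hK⟩).val ≤ n / 2) :
    Inv n K p q {⟨0, hK⟩} (Finset.univ.erase ⟨0, hK⟩) (M0T n K units L OC) (sbit n 0)
      (Nat.xor (mkTC n K units).sent (sbit n 0)) := by
  set i0 : Fin K := ⟨0, hK⟩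
  have hval0 : (p i0).val = 0 := by rw [hp0, ZMod.val_zero]
  have hkill : ∀ (l' : Fin K) (x : ZMod n), InA p q l' x → x ≠ p i0 →
      (killT n K units L OC 0 0).testBit (64 + l'.val * (2 * n) + x.val) = false := by
    intro l' x hx hne
    have := kill_false units hn hK hM hD (inA_p i0) hx hne
    rwa [hval0] at this
  refine ⟨?_, ?_, ?_, ?_, ?_, ?_⟩
  · simp
  · intro i
    rw [sbit_eq, Nat.testBit_two_pow]
    constructor
    · intro h; exact ⟨i0, Finset.mem_singleton_self _, (of_decide_eq_true h).symm⟩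
    · rintro ⟨l, hl, rfl⟩; rw [Finset.mem_singleton] at hl; subst hl; simp [i0]
  · exact sent_xor hn (O := Finset.univ) (fun i => by rw [testBit_sent_iff units hn]; simp) i0 _
      (fun l2 => by rw [Finset.mem_erase]; simp)
  · intro l
    rw [posn_eq, testBit_M0T units hn64 hD.ltL l.isLt (by omega) le_rfl]
    unfold killT
    rw [testBit_kill_off units _ _ _ (Or.inr ⟨l.val, n, by omega, rfl, Or.inl le_rfl⟩), testBit_cut0 units l.isLt (by omega)]
    simp
  · intro l hl
    have hli : l ≠ i0 := Finset.ne_of_mem_erase hl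
    have hl0 : l.val ≠ 0 := fun e => hli (Fin.ext e)
    constructor
    · rw [posn_eq, testBit_M0T units hn64 hD.ltL l.isLt (by have := ZMod.val_lt (p l); omega) (le_of_lt (ZMod.val_lt _)),
        hkill l (p l) (inA_p l) (ne_of_classes hM (Ne.symm hli) (inA_p i0) (inA_p l)),
        testBit_cut0 units l.isLt (by have := ZMod.val_lt (p l); omega)]
      simp [hl0, le_of_lt (ZMod.val_lt (p l))]
    · rw [posn_eq, testBit_M0T units hn64 hD.ltL l.isLt (by have := ZMod.val_lt (q l); omega) (le_of_lt (ZMod.val_lt _)),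
        hkill l (q l) (inA_q l) (ne_of_classes hM (Ne.symm hli) (inA_p i0) (inA_q l)),
        testBit_cut0 units l.isLt (by have := ZMod.val_lt (q l); omega)]
      simp [hl0, le_of_lt (ZMod.val_lt (q l))]
  · intro l hl
    rw [Finset.mem_singleton] at hl; subst hl
    rw [posn_eq, testBit_M0T units hn64 hD.ltL i0.isLt (by have := ZMod.val_lt (q i0); omega) (le_of_lt (ZMod.val_lt _)),
      hkill i0 (q i0) (inA_q i0) (fun e => hM.1 i0 e.symm), testBit_cut0 units i0.isLt (by have := ZMod.val_lt (q i0); omega)]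
    simp [i0, ZMod.val_lt (q ⟨0, hK⟩), hq0]

/-- **THE LEAF NEVER REFUTES A NORMALISED SOLUTION.** -/
theorem leaf_false (hn : 1 ≤ n) (hn64 : n ≤ 64) (hK : 1 ≤ K) (hM : ModelD p q cz) (hD : LeafData n K L (OCT n K units L) cz)
    (hor : ∀ l, (p l).val < (q l).val) (hp0 : p ⟨0, hK⟩ = 0) (hq0 : 1 ≤ (q ⟨0, hK⟩).val ∧ (q ⟨0, hK⟩).val ≤ n / 2)
    (h : tleaf (mkTC n K units) L (maskL L) = true) : False := by
  have h1 := (tleaf_true units h).2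
  rw [psearch_false units hn hK hM hD hor _ _ _ _ _ _ (inv_init units hn hn64 hK hM hD hp0 hq0)] at h1
  exact Bool.noConfusion h1

end Leaf

end SPhase2

end STPP211T

end Summit.MatrixMultiplication.OmegaCensus
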